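import Summits.Ventures.CertifiedManyBodySolver.Upper.IntervalReaderHubbardKernel

/-!
# Ventures/CertifiedManyBodySolver — Upper/IntervalReaderQuadAutomaton.lean: the `l3core-sgf` automaton (general quadratic + density words)
(part 19 of the Theorem-H1′ package; parts 1–18: `IntervalReaderSchur` … `IntervalReaderBoxKernel`)

HONEST FRAMING: first certified bounds; not a superconductivity verdict; every number certified or labelled
float.  Definitions and bookkeeping lemmas; no number is certified here, no row moves; a sourced-Hamiltonian
upper is a certified variational ENERGY CEILING, never a sign of order.

Parts 14–15 did E1's `hubbard_mpo.py` automaton (same-spin hopping between sites + on-site words).  The W5 /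
FORMAT-mpsgf1 reader `l3core-sgf` (IRD desk seat 3; `sgf_model.ModeQuadModel.mode_mpo`, composed to site level by
the verbatim `site_mpo` rule) runs the SAME depth-one automaton for a GENERAL model on `M = 2N` modes
`p = (site x, s ∈ Fin 2)`:  `H = Σ_{p<q} τ_pq (c†_p c_q + c†_q c_p) + Σ_p ε_p n_p + Σ_{p<q} V_pq n_p n_q + C` —
hopping between ANY two modes (also `s ≠ s′`, also inside one site), density–density words between any two modes,
closing weights `+τ` (not `−W`), and one `('nn', p, q)` channel PER PAIR carrying the identity.  This file writes
that automaton at site level in the tree's one-site matrices: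

* `QState N = Bool ⊕ (Bool × Fin N × Fin 2) ⊕ ((Fin N × Fin 2) × (Fin N × Fin 2))` — `FINAL`, `START`, the
  hopping channels `qdag x s` / `qann x s` (E1's `('dag', p)` / `('ann', p)`, `p = 2x+s`), and the pair channels
  `qnn x s y s′` (E1's `('nn', p, q)`);
* `quadAutomaton τ ν V k` — the table at site `k` for cross-site hopping weights `τ x s y s′` and density weights
  `ν x s y s′` (both read for `x < y`) and on-site words `V k` (into which `site_mpo` folds everything that opens and
  closes inside site `k`: `ε`, the intra-site pair `τ_{(k,0),(k,1)}`, `V_{(k,0),(k,1)}`, `C`):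
  `fin → fin : 1`, `start → start : 1`, `start → fin : V k`;
  open `start → qdag k s : c†_s F`, `start → qann k s : F c_s` iff a hopping partner lies on a LATER site;
  pass `qdag/qann x s → itself : F` (`x < k`) iff a partner lies beyond `k`;
  close `qdag x s → fin : Σ_{s′} τ x s k s′ • c_{s′}`, `qann x s → fin : Σ_{s′} τ x s k s′ • c†_{s′}` (`x < k`; both
  modes of site `k` can be the partner — `site_mpo` adds the two rows);
  open `start → qnn k s y s′ : n_s` iff `k < y ∧ ν ≠ 0`; pass `qnn x s y s′ → itself : 1` (`x < k < y`);
  close `qnn x s y s′ → fin : ν x s y s′ • n_{s′}` at `k = y`; everything else `0`;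
* table-entry lemmas and the depth-one lemmas `quadAutomaton_fin_of_ne` / `quadAutomaton_channel_of_ne` (the
  hypotheses of part 13's `automatonKernel_source_apply`).

Part 20 (`IntervalReaderQuadKernel`) proves the `(START, FINAL)` kernel identity.  The basis-reading convention is
part 16's (`e1Index`; `sgf_model` uses `hubbard_mpo`'s conventions verbatim: "l3core's s = 2 n_up + n_dn with 'up' :=
mode 2r").
-/

noncomputable section

open Matrix Finset
open scoped BigOperators ComplexOrder

namespace Summit.Ventures.CertifiedManyBodySolver.Upper.IntervalReader

open Literature.MathematicalPhysics.QuantumLattice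
open Literature.MathematicalPhysics.QuantumLattice.JordanWigner

section Quad

variable {N : ℕ}

/-- The states of the `l3core-sgf` automaton, one global alphabet: `Sum.inl false` = `FINAL`, `Sum.inl true` =
`START`, `Sum.inr (Sum.inl (false, x, s))` = `('dag', 2x+s)`, `Sum.inr (Sum.inl (true, x, s))` = `('ann', 2x+s)`,
`Sum.inr (Sum.inr ((x, s), (y, s′)))` = `('nn', 2x+s, 2y+s′)`. -/
abbrev QState (N : ℕ) : Type := Bool ⊕ ((Bool × Fin N × Fin 2) ⊕ ((Fin N × Fin 2) × (Fin N × Fin 2)))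

/-- `FINAL`. -/
abbrev QState.fin : QState N := Sum.inl false

/-- `START`. -/
abbrev QState.start : QState N := Sum.inl true

/-- The hopping channel «`c†_{(x,s)}` placed, string running» (`('dag', 2x+s)`). -/
abbrev QState.qdag (x : Fin N) (s : Fin 2) : QState N := Sum.inr (Sum.inl (false, x, s))

/-- The hopping channel «`c_{(x,s)}` placed, string running» (`('ann', 2x+s)`). -/
abbrev QState.qann (x : Fin N) (s : Fin 2) : QState N := Sum.inr (Sum.inl (true, x, s))

/-- The density channel «`n_{(x,s)}` placed, awaiting `n_{(y,s′)}`» (`('nn', 2x+s, 2y+s′)`). -/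
abbrev QState.qnn (x : Fin N) (s : Fin 2) (y : Fin N) (s' : Fin 2) : QState N := Sum.inr (Sum.inr ((x, s), (y, s')))

/-- `START ≠ FINAL`. -/
theorem QState.start_ne_fin : (QState.start : QState N) ≠ QState.fin := by
  simp

variable (τ ν : Fin N → Fin 2 → Fin N → Fin 2 → ℂ) (V : Fin N → Matrix (Fin 4) (Fin 4) ℂ)

open Classical in
/-- **The `l3core-sgf` automaton at site level** (`sgf_model.mode_mpo` ∘ `site_mpo`); see the module docstring for
the rows.  «A hopping partner beyond site `k`» for the channel of mode `(x, s)`: `∃ y, k < y ∧ ∃ s′, τ x s y s′ ≠ 0`. -/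
def quadAutomaton (k : Fin N) : QState N → QState N → Matrix (Fin 4) (Fin 4) ℂ
  | Sum.inl false, Sum.inl false => 1
  | Sum.inl true, Sum.inl true => 1
  | Sum.inl true, Sum.inl false => V k
  | Sum.inl true, Sum.inr (Sum.inl (false, x, s)) =>
      if x = k ∧ (∃ y, k < y ∧ ∃ s', τ k s y s' ≠ 0) then siteCreation s * siteParity else 0
  | Sum.inl true, Sum.inr (Sum.inl (true, x, s)) =>
      if x = k ∧ (∃ y, k < y ∧ ∃ s', τ k s y s' ≠ 0) then siteParity * siteAnnihilation s else 0
  | Sum.inr (Sum.inl (false, x, s)), Sum.inr (Sum.inl (false, x', s')) =>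
      if x' = x ∧ s' = s ∧ x < k ∧ (∃ y, k < y ∧ ∃ s'', τ x s y s'' ≠ 0) then siteParity else 0
  | Sum.inr (Sum.inl (true, x, s)), Sum.inr (Sum.inl (true, x', s')) =>
      if x' = x ∧ s' = s ∧ x < k ∧ (∃ y, k < y ∧ ∃ s'', τ x s y s'' ≠ 0) then siteParity else 0
  | Sum.inr (Sum.inl (false, x, s)), Sum.inl false =>
      if x < k then ∑ s', τ x s k s' • siteAnnihilation s' else 0
  | Sum.inr (Sum.inl (true, x, s)), Sum.inl false =>
      if x < k then ∑ s', τ x s k s' • siteCreation s' else 0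
  | Sum.inl true, Sum.inr (Sum.inr ((x, s), (y, s'))) =>
      if x = k ∧ k < y ∧ ν k s y s' ≠ 0 then siteNumber s else 0
  | Sum.inr (Sum.inr ((x, s), (y, s'))), Sum.inr (Sum.inr ((x', s''), (y', s'''))) =>
      if x' = x ∧ s'' = s ∧ y' = y ∧ s''' = s' ∧ x < k ∧ k < y ∧ ν x s y s' ≠ 0 then 1 else 0
  | Sum.inr (Sum.inr ((x, s), (y, s'))), Sum.inl false =>
      if x < k ∧ y = k then ν x s k s' • siteNumber s' else 0
  | Sum.inl false, Sum.inl true => 0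
  | Sum.inl false, Sum.inr _ => 0
  | Sum.inr _, Sum.inl true => 0
  | Sum.inr (Sum.inl (false, _, _)), Sum.inr (Sum.inl (true, _, _)) => 0
  | Sum.inr (Sum.inl (true, _, _)), Sum.inr (Sum.inl (false, _, _)) => 0
  | Sum.inr (Sum.inl _), Sum.inr (Sum.inr _) => 0
  | Sum.inr (Sum.inr _), Sum.inr (Sum.inl _) => 0

/-- Table entry `fin → fin = 1`. -/
@[simp] theorem quadAutomaton_fin_fin (k : Fin N) : quadAutomaton τ ν V k QState.fin QState.fin = 1 := rfl

/-- Table entry `start → start = 1`. -/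
@[simp] theorem quadAutomaton_start_start (k : Fin N) : quadAutomaton τ ν V k QState.start QState.start = 1 := rfl

/-- Table entry `start → fin = V k`. -/
@[simp] theorem quadAutomaton_start_fin (k : Fin N) : quadAutomaton τ ν V k QState.start QState.fin = V k := rfl

open Classical in
/-- Table entry: opening a `dag` channel. -/
theorem quadAutomaton_start_qdag (k x : Fin N) (s : Fin 2) :
    quadAutomaton τ ν V k QState.start (QState.qdag x s) =
      if x = k ∧ (∃ y, k < y ∧ ∃ s', τ k s y s' ≠ 0) then siteCreation s * siteParity else 0 := rfl

open Classical in
/-- Table entry: opening an `ann` channel. -/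
theorem quadAutomaton_start_qann (k x : Fin N) (s : Fin 2) :
    quadAutomaton τ ν V k QState.start (QState.qann x s) =
      if x = k ∧ (∃ y, k < y ∧ ∃ s', τ k s y s' ≠ 0) then siteParity * siteAnnihilation s else 0 := rfl

open Classical in
/-- Table entry: a `dag` channel passing a site. -/
theorem quadAutomaton_qdag_qdag (k x : Fin N) (s : Fin 2) :
    quadAutomaton τ ν V k (QState.qdag x s) (QState.qdag x s) =
      if x < k ∧ (∃ y, k < y ∧ ∃ s'', τ x s y s'' ≠ 0) then siteParity else 0 := by
  simp [quadAutomaton]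

open Classical in
/-- Table entry: an `ann` channel passing a site. -/
theorem quadAutomaton_qann_qann (k x : Fin N) (s : Fin 2) :
    quadAutomaton τ ν V k (QState.qann x s) (QState.qann x s) =
      if x < k ∧ (∃ y, k < y ∧ ∃ s'', τ x s y s'' ≠ 0) then siteParity else 0 := by
  simp [quadAutomaton]

/-- Table entry: a `dag` channel closing (at either mode of site `k`). -/
theorem quadAutomaton_qdag_fin (k x : Fin N) (s : Fin 2) :
    quadAutomaton τ ν V k (QState.qdag x s) QState.fin =
      if x < k then ∑ s', τ x s k s' • siteAnnihilation s' else 0 := rfl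

/-- Table entry: an `ann` channel closing. -/
theorem quadAutomaton_qann_fin (k x : Fin N) (s : Fin 2) :
    quadAutomaton τ ν V k (QState.qann x s) QState.fin =
      if x < k then ∑ s', τ x s k s' • siteCreation s' else 0 := rfl

open Classical in
/-- Table entry: opening a density channel. -/
theorem quadAutomaton_start_qnn (k x : Fin N) (s : Fin 2) (y : Fin N) (s' : Fin 2) :
    quadAutomaton τ ν V k QState.start (QState.qnn x s y s') =
      if x = k ∧ k < y ∧ ν k s y s' ≠ 0 then siteNumber s else 0 := rfl

open Classical in
/-- Table entry: a density channel passing a site. -/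
theorem quadAutomaton_qnn_qnn (k x : Fin N) (s : Fin 2) (y : Fin N) (s' : Fin 2) :
    quadAutomaton τ ν V k (QState.qnn x s y s') (QState.qnn x s y s') =
      if x < k ∧ k < y ∧ ν x s y s' ≠ 0 then 1 else 0 := by
  simp [quadAutomaton]

open Classical in
/-- Table entry: a density channel closing. -/
theorem quadAutomaton_qnn_fin (k x : Fin N) (s : Fin 2) (y : Fin N) (s' : Fin 2) :
    quadAutomaton τ ν V k (QState.qnn x s y s') QState.fin =
      if x < k ∧ y = k then ν x s k s' • siteNumber s' else 0 := rfl

/-- `FINAL` is absorbing. -/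
theorem quadAutomaton_fin_of_ne (k : Fin N) :
    ∀ c : QState N, c ≠ QState.fin → quadAutomaton τ ν V k QState.fin c = 0
  | Sum.inl false, h => absurd rfl h
  | Sum.inl true, _ => rfl
  | Sum.inr (Sum.inl _), _ => rfl
  | Sum.inr (Sum.inr _), _ => rfl

/-- Channels move only to themselves or to `FINAL` (depth one). -/
theorem quadAutomaton_channel_of_ne (k : Fin N) : ∀ b c : QState N,
    b ≠ QState.start → b ≠ QState.fin → c ≠ b → c ≠ QState.fin → quadAutomaton τ ν V k b c = 0
  | Sum.inl false, _, _, h, _, _ => absurd rfl h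
  | Sum.inl true, _, h, _, _, _ => absurd rfl h
  | Sum.inr _, Sum.inl false, _, _, _, h => absurd rfl h
  | Sum.inr (Sum.inl (false, _, _)), Sum.inl true, _, _, _, _ => rfl
  | Sum.inr (Sum.inl (true, _, _)), Sum.inl true, _, _, _, _ => rfl
  | Sum.inr (Sum.inr _), Sum.inl true, _, _, _, _ => rfl
  | Sum.inr (Sum.inl (false, _, _)), Sum.inr (Sum.inl (true, _, _)), _, _, _, _ => rfl
  | Sum.inr (Sum.inl (true, _, _)), Sum.inr (Sum.inl (false, _, _)), _, _, _, _ => rfl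
  | Sum.inr (Sum.inl (false, _, _)), Sum.inr (Sum.inr _), _, _, _, _ => rfl
  | Sum.inr (Sum.inl (true, _, _)), Sum.inr (Sum.inr _), _, _, _, _ => rfl
  | Sum.inr (Sum.inr _), Sum.inr (Sum.inl (false, _, _)), _, _, _, _ => rfl
  | Sum.inr (Sum.inr _), Sum.inr (Sum.inl (true, _, _)), _, _, _, _ => rfl
  | Sum.inr (Sum.inl (false, x, s)), Sum.inr (Sum.inl (false, x', s')), _, _, h, _ => by
      simp only [quadAutomaton]
      rw [if_neg]
      rintro ⟨rfl, rfl, -⟩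
      exact h rfl
  | Sum.inr (Sum.inl (true, x, s)), Sum.inr (Sum.inl (true, x', s')), _, _, h, _ => by
      simp only [quadAutomaton]
      rw [if_neg]
      rintro ⟨rfl, rfl, -⟩
      exact h rfl
  | Sum.inr (Sum.inr ((x, s), (y, s'))), Sum.inr (Sum.inr ((x', s''), (y', s'''))), _, _, h, _ => by
      simp only [quadAutomaton]
      rw [if_neg]
      rintro ⟨rfl, rfl, rfl, rfl, -⟩
      exact h rfl

/-! ## §BB′  Liveness (appended 2026-08-27): `sgf_model`'s per-cut `alloc` drops only zero rows and columns -/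

/-- **No way into a dead hopping channel.**  If after site `k` the hopping channel of mode `(x, s)` has no partner on a
later site (`¬ (x ≤ k ∧ ∃ y > k, ∃ s′, τ x s y s′ ≠ 0)`), no transition at site `k` enters `qdag x s` or `qann x s`. -/
theorem quadAutomaton_to_dead_hop (k x : Fin N) (s : Fin 2) (h : ¬ (x ≤ k ∧ ∃ y, k < y ∧ ∃ s', τ x s y s' ≠ 0)) :
    ∀ b' : QState N, quadAutomaton τ ν V k b' (QState.qdag x s) = 0 ∧ quadAutomaton τ ν V k b' (QState.qann x s) = 0
  | Sum.inl false => ⟨rfl, rfl⟩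
  | Sum.inl true => by
      refine ⟨?_, ?_⟩
      · rw [quadAutomaton_start_qdag, if_neg]
        rintro ⟨rfl, hl⟩
        exact h ⟨le_rfl, hl⟩
      · rw [quadAutomaton_start_qann, if_neg]
        rintro ⟨rfl, hl⟩
        exact h ⟨le_rfl, hl⟩
  | Sum.inr (Sum.inl (false, x', s')) => by
      refine ⟨?_, rfl⟩
      simp only [quadAutomaton]
      rw [if_neg]
      rintro ⟨rfl, rfl, hlt, hl⟩
      exact h ⟨hlt.le, hl⟩
  | Sum.inr (Sum.inl (true, x', s')) => by
      refine ⟨rfl, ?_⟩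
      simp only [quadAutomaton]
      rw [if_neg]
      rintro ⟨rfl, rfl, hlt, hl⟩
      exact h ⟨hlt.le, hl⟩
  | Sum.inr (Sum.inr _) => ⟨rfl, rfl⟩

/-- **No way into a dead density channel.**  If after site `k` the pair channel `(x, s) → (y, s′)` is not running
(`¬ (x ≤ k ∧ k < y ∧ ν x s y s′ ≠ 0)`), no transition at site `k` enters `qnn x s y s′`. -/
theorem quadAutomaton_to_dead_nn (k x : Fin N) (s : Fin 2) (y : Fin N) (s' : Fin 2)
    (h : ¬ (x ≤ k ∧ k < y ∧ ν x s y s' ≠ 0)) :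
    ∀ b' : QState N, quadAutomaton τ ν V k b' (QState.qnn x s y s') = 0
  | Sum.inl false => rfl
  | Sum.inl true => by
      rw [quadAutomaton_start_qnn, if_neg]
      rintro ⟨rfl, hlt, hν⟩
      exact h ⟨le_rfl, hlt, hν⟩
  | Sum.inr (Sum.inl (false, _, _)) => rfl
  | Sum.inr (Sum.inl (true, _, _)) => rfl
  | Sum.inr (Sum.inr ((x₂, s₂), (y₂, s₃))) => by
      simp only [quadAutomaton]
      rw [if_neg]
      rintro ⟨rfl, rfl, rfl, rfl, hlt, hlt', hν⟩
      exact h ⟨hlt.le, hlt', hν⟩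

/-- A sweep step into a state nothing enters is the zero environment: dead channels of the `l3core-sgf` automaton
carry the exact environment `0`, so assigning the reader's absent environments the value `0` there costs no defect in
part 12's hypotheses. -/
theorem quadAutomatonStep_dead {D : ℕ} (A : MPSTensor 4 D) (Ok : QState N → QState N → Matrix (Fin 4) (Fin 4) ℂ)
    (c : QState N) (hc : ∀ b', Ok b' c = 0) (Y : QState N → Matrix (Fin D) (Fin D) ℂ) :
    ∑ b', transferOp A (Ok b' c) (Y b') = 0 :=
  Finset.sum_eq_zero fun b' _ => by rw [hc b']; simp [transferOp]

end Quad

end Summit.Ventures.CertifiedManyBodySolver.Upper.IntervalReader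

end
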